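import Summits.QuantumFields.YangMills.Theorems.BalabanLadderNTSharpPlaquetteMoments
import Summits.QuantumFields.YangMills.Theorems.BalabanLadderIRAfOnsetLatticeAF
import HarnessLib

/-!
# Crux `NT` (stmt-QuantumFields-19353): the SHARP volume-uniform two-point ceiling `|Q2| ≤ K/(β²·min(s,1)⁸)` and the unit
# envelope `a(β) ≤ K·β^{−1/4}` of an NT unit — NO logarithm, hypothesis-free

Fleet lead prover of crux `NT` (unit `ym-spine-19353-p1`, g28), `--supports` helper; sequel of
`Theorems/BalabanLadderNTSharpPlaquetteMoments` (sharp plaquette moments `⟨φ_q⟩ ≤ K/β`, `⟨φ_q²⟩ ≤ K/β²` on every odd torus at every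
`β ≥ 4`, from the torus doubling of crux `FemtoCurvatureTwoPointC`).  Run through the bodies of the tree's log-carrying ceilings:

* §1 **`exists_abs_torusCov_dens_le_sharp`** — `|Cov_{T,β}(A_x, A_y)| ≤ W/β²` for ALL sites `x, y`, all odd tori `2L+1 ≥ 3`, all
  `β ≥ 4` (body of `AfOnset.exists_abs_torusCov_dens_le`: `|Cov(Φ_x, Φ_y)| ≤ ½(⟨Φ_x²⟩ + ⟨Φ_y²⟩) + ⟨Φ_x⟩⟨Φ_y⟩`, Cauchy–Schwarz over
  the six orientations; no decay in `|x − y|` is claimed).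
* §2 **`exists_abs_Q2_le_sharp`** — `|Q2 G r β L s f g| ≤ K/(β²·min(s,1)⁸)` for all `L ≥ 1`, `β ≥ 4`, `s > 0` and any test functions
  (body of `AfOnset.exists_abs_Q2_le_log_sq` with the Schwartz lattice sums `AfOnset.exists_sum_abs_schwartz_lattice_le_div_min`).
* §3 **the unit envelope of an NT unit, sharpened** (bodies of `UnitNormalForm.§1`): `unit_calibration_of_q2Floor_sharp`
  (`min(a β, 1)⁸·β² ≤ K`), `unit_pow_eight_le_of_q2Floor_sharp` / `unit_pow_eight_le_of_lowerBounds_sharp` (eventually `a β < 1` and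
  **`a β⁸ ≤ K/β²`**), `unit_le_rpow_of_lowerBounds` (**`a β ≤ K^{1/8}·β^{−1/4}`**): a positive unit map carrying clause (i) of
  `LowerBounds G r a` — in particular the unit of `BalabanLadder.NT` — is at least as fine as `β^{−1/4}`, with no logarithm (the
  two-loop unit of record `e^{−β/(4b₀)}(β/(2b₀))^{b₁/(2b₀²)}` lies exponentially inside).

HONEST FRAMING.  Elementary given the cited tree theorems; kinematic weak-coupling bookkeeping for every compact gauge group; a
CEILING and an envelope, not a floor: nothing of NT's β-uniform two-point floor (dimensional transmutation), the seam or the gap.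
NT is NOT proved; the Yang–Mills mass gap is NOT proved; not Clay.
-/

set_option autoImplicit false

noncomputable section

open MeasureTheory Filter Topology Finset
open scoped BigOperators SchwartzMap
open Literature.MathematicalPhysics.QuantumFieldTheory hiding ZdEdge
open Literature.MathematicalPhysics.QuantumLattice
open Literature.Probability.LatticeModels (box mem_box)
open Summit.QuantumFields.YangMills.Cruxes.OSLegsFromFemtoAndGap.DlrCollarTransfer
open Summit.QuantumFields.YangMills.Cruxes.IR.AfOnset (dens_torusLift_eq integral_const_sub_mul_const_sub
  exists_sum_abs_schwartz_lattice_le_div_min)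
open Literature.MathematicalPhysics.QuantumFieldTheory.WilsonRP (plaqRe abs_plaqRe_le measurable_plaqRe)

namespace Summit.QuantumFields.YangMills.Cruxes.NT.SharpCeilings

/-! ## §1 The sharp covariance ceiling for the action density -/

section Covariance

variable {G : Type} [Group G] [TopologicalSpace G] [IsTopologicalGroup G] [CompactSpace G]
  [MeasurableSpace G] [BorelSpace G] (r : LatticeRep G)

/-- **Volume-uniform covariance bound for the action density at weak coupling, WITHOUT the logarithm.**  There is `W ≥ 0` with
`|Cov_{β, 2L+1}(A_x, A_y)| ≤ W/β²` for all sites `x, y ∈ ℤ⁴`, every odd torus `2L+1 ≥ 3` and every `β ≥ 4`. [folklore] -/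
-- adapted from `AfOnset.exists_abs_torusCov_dens_le` (`Theorems/BalabanLadderIRAfOnsetCovariance`), with the sharp moments
theorem exists_abs_torusCov_dens_le_sharp :
    ∃ W : ℝ, 0 ≤ W ∧ ∀ (L : ℕ), 1 ≤ L → ∀ β : ℝ, 4 ≤ β → ∀ x y : Fin 4 → ℤ,
      |torusE G r β L (fun U => dens G r x U * dens G r y U) -
          torusE G r β L (dens G r x) * torusE G r β L (dens G r y)| ≤ W / β ^ 2 := by
  haveI : SecondCountableTopology G :=
    (r.continuous.isClosedEmbedding r.injective).isEmbedding.secondCountableTopology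
  obtain ⟨K, hK0, hK⟩ := exists_plaquetteCost_moments_le_sharp G r
  obtain ⟨m, hmdef⟩ : ∃ m : ℝ, m = (Fintype.card {q : Fin 4 × Fin 4 // q.1 < q.2} : ℝ) := ⟨_, rfl⟩
  have hm0 : 0 ≤ m := by rw [hmdef]; exact Nat.cast_nonneg _
  obtain ⟨N, hNdef⟩ : ∃ N : ℝ, N = (r.N : ℝ) := ⟨_, rfl⟩
  have hN0 : 0 ≤ N := by rw [hNdef]; exact Nat.cast_nonneg _
  refine ⟨m ^ 2 * K + (m * K) ^ 2, by positivity, fun L hL β hβ x y => ?_⟩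
  have hβ0 : 0 < β := by linarith
  haveI := isProbabilityMeasure_wilsonMeasure (d := 4) (L := 2 * L + 1) r.ρ r.continuous β
  -- per-plaquette facts: measurable, values in `[0, 2N]`, moments
  have hq : ∀ q : Plaquette 4 (2 * L + 1),
      Measurable (fun U : GaugeConfig 4 (2 * L + 1) G => plaquetteCost r.ρ U q) ∧
      (∀ U, 0 ≤ plaquetteCost r.ρ U q ∧ plaquetteCost r.ρ U q ≤ 2 * N) := by
    intro q
    refine ⟨measurable_const.sub (measurable_plaqRe r.ρ r.continuous q), fun U => ?_⟩
    have h := abs_le.1 (abs_plaqRe_le r.ρ r.continuous U q)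
    change 0 ≤ (r.N : ℝ) - plaqRe r.ρ U q ∧ (r.N : ℝ) - plaqRe r.ρ U q ≤ 2 * N
    rw [← hNdef] at h ⊢
    constructor <;> linarith [h.1, h.2]
  have hqint : ∀ q : Plaquette 4 (2 * L + 1),
      Integrable (fun U : GaugeConfig 4 (2 * L + 1) G => plaquetteCost r.ρ U q)
        (wilsonMeasure (d := 4) (L := 2 * L + 1) r.ρ β) := fun q =>
    integrable_of_bound (hq q).1.aestronglyMeasurable (C := 2 * N) fun U => by
      rw [abs_of_nonneg ((hq q).2 U).1]; exact ((hq q).2 U).2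
  have hq2int : ∀ q : Plaquette 4 (2 * L + 1),
      Integrable (fun U : GaugeConfig 4 (2 * L + 1) G => plaquetteCost r.ρ U q ^ 2)
        (wilsonMeasure (d := 4) (L := 2 * L + 1) r.ρ β) := fun q =>
    integrable_of_bound ((hq q).1.pow_const 2).aestronglyMeasurable (C := (2 * N) ^ 2) fun U => by
      rw [abs_of_nonneg (sq_nonneg _)]; exact pow_le_pow_left₀ ((hq q).2 U).1 ((hq q).2 U).2 2
  have hmom1 : ∀ q : Plaquette 4 (2 * L + 1),
      ∫ U, plaquetteCost r.ρ U q ∂(wilsonMeasure (d := 4) (L := 2 * L + 1) r.ρ β) ≤ K / β :=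
    fun q => (hK L hL β hβ q).1
  have hmom2 : ∀ q : Plaquette 4 (2 * L + 1),
      ∫ U, plaquetteCost r.ρ U q ^ 2 ∂(wilsonMeasure (d := 4) (L := 2 * L + 1) r.ρ β) ≤ K / β ^ 2 :=
    fun q => (hK L hL β hβ q).2
  -- the plaquette sums `Φ_z` and the constant `c`
  obtain ⟨Φ, hΦ⟩ : ∃ Φ : (Fin 4 → ℤ) → GaugeConfig 4 (2 * L + 1) G → ℝ, ∀ z, Φ z = fun U =>
      ∑ q : {q : Fin 4 × Fin 4 // q.1 < q.2},
        plaquetteCost r.ρ U (Literature.Probability.LatticeModels.Torus.proj (2 * L + 1) z, q) :=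
    ⟨_, fun _ => rfl⟩
  obtain ⟨c, hc⟩ : ∃ c : ℝ, c = ∑ _q : {q : Fin 4 × Fin 4 // q.1 < q.2}, N := ⟨_, rfl⟩
  have hdens : ∀ (z : Fin 4 → ℤ) (U : GaugeConfig 4 (2 * L + 1) G),
      dens G r z (torusLift (2 * L + 1) U) = c - Φ z U := by
    intro z U
    rw [dens_torusLift_eq, Finset.sum_sub_distrib, hΦ z, hc, hNdef]
  have hΦm : ∀ z, Measurable (Φ z) := fun z => by
    rw [hΦ z]; exact Finset.measurable_sum _ fun q _ => (hq _).1
  have hΦ0 : ∀ z U, 0 ≤ Φ z U := fun z U => by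
    rw [hΦ z]; exact Finset.sum_nonneg fun q _ => ((hq _).2 U).1
  have hΦB : ∀ z U, Φ z U ≤ m * (2 * N) := by
    intro z U
    rw [hΦ z]
    calc ∑ q : {q : Fin 4 × Fin 4 // q.1 < q.2},
          plaquetteCost r.ρ U (Literature.Probability.LatticeModels.Torus.proj (2 * L + 1) z, q)
        ≤ ∑ _q : {q : Fin 4 × Fin 4 // q.1 < q.2}, 2 * N := Finset.sum_le_sum fun q _ => ((hq _).2 U).2
      _ = m * (2 * N) := by rw [Finset.sum_const, nsmul_eq_mul, Finset.card_univ, hmdef]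
  have hΦint : ∀ z, Integrable (Φ z) (wilsonMeasure (d := 4) (L := 2 * L + 1) r.ρ β) := fun z =>
    integrable_of_bound (hΦm z).aestronglyMeasurable (C := m * (2 * N)) fun U => by
      rw [abs_of_nonneg (hΦ0 z U)]; exact hΦB z U
  have hΦ2int : ∀ z, Integrable (fun U => Φ z U ^ 2) (wilsonMeasure (d := 4) (L := 2 * L + 1) r.ρ β) := fun z =>
    integrable_of_bound ((hΦm z).pow_const 2).aestronglyMeasurable (C := (m * (2 * N)) ^ 2) fun U => by
      rw [abs_of_nonneg (sq_nonneg _)]; exact pow_le_pow_left₀ (hΦ0 z U) (hΦB z U) 2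
  have hΦΦint : Integrable (fun U => Φ x U * Φ y U) (wilsonMeasure (d := 4) (L := 2 * L + 1) r.ρ β) :=
    integrable_of_bound ((hΦm x).mul (hΦm y)).aestronglyMeasurable (C := (m * (2 * N)) * (m * (2 * N)))
      fun U => by
        rw [abs_mul, abs_of_nonneg (hΦ0 x U), abs_of_nonneg (hΦ0 y U)]
        exact mul_le_mul (hΦB x U) (hΦB y U) (hΦ0 y U) (by positivity)
  have hmean : ∀ z, ∫ U, Φ z U ∂(wilsonMeasure (d := 4) (L := 2 * L + 1) r.ρ β) ≤ m * (K / β) := by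
    intro z
    rw [hΦ z, integral_finsetSum _ fun q _ => hqint _]
    calc ∑ q : {q : Fin 4 × Fin 4 // q.1 < q.2},
          ∫ U, plaquetteCost r.ρ U (Literature.Probability.LatticeModels.Torus.proj (2 * L + 1) z, q)
            ∂(wilsonMeasure (d := 4) (L := 2 * L + 1) r.ρ β)
        ≤ ∑ _q : {q : Fin 4 × Fin 4 // q.1 < q.2}, K / β := Finset.sum_le_sum fun q _ => hmom1 _
      _ = m * (K / β) := by rw [Finset.sum_const, nsmul_eq_mul, Finset.card_univ, hmdef]
  have hsq : ∀ z, ∫ U, Φ z U ^ 2 ∂(wilsonMeasure (d := 4) (L := 2 * L + 1) r.ρ β) ≤ m * (m * (K / β ^ 2)) := by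
    intro z
    have hpt : ∀ U, Φ z U ^ 2 ≤ m * ∑ q : {q : Fin 4 × Fin 4 // q.1 < q.2},
        plaquetteCost r.ρ U (Literature.Probability.LatticeModels.Torus.proj (2 * L + 1) z, q) ^ 2 := by
      intro U
      have h := sq_sum_le_card_mul_sum_sq (s := (Finset.univ : Finset {q : Fin 4 × Fin 4 // q.1 < q.2}))
        (f := fun q => plaquetteCost r.ρ U (Literature.Probability.LatticeModels.Torus.proj (2 * L + 1) z, q))
      rw [Finset.card_univ, ← hmdef] at h
      rw [hΦ z]
      exact h
    have hint0 : Integrable (fun U => ∑ q : {q : Fin 4 × Fin 4 // q.1 < q.2},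
        plaquetteCost r.ρ U (Literature.Probability.LatticeModels.Torus.proj (2 * L + 1) z, q) ^ 2)
        (wilsonMeasure (d := 4) (L := 2 * L + 1) r.ρ β) :=
      integrable_finsetSum _ fun q _ => hq2int _
    calc ∫ U, Φ z U ^ 2 ∂(wilsonMeasure (d := 4) (L := 2 * L + 1) r.ρ β)
        ≤ ∫ U, m * ∑ q : {q : Fin 4 × Fin 4 // q.1 < q.2},
            plaquetteCost r.ρ U (Literature.Probability.LatticeModels.Torus.proj (2 * L + 1) z, q) ^ 2
              ∂(wilsonMeasure (d := 4) (L := 2 * L + 1) r.ρ β) :=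
          integral_mono (hΦ2int z) (hint0.const_mul m) hpt
      _ = m * ∑ q : {q : Fin 4 × Fin 4 // q.1 < q.2},
            ∫ U, plaquetteCost r.ρ U (Literature.Probability.LatticeModels.Torus.proj (2 * L + 1) z, q) ^ 2
              ∂(wilsonMeasure (d := 4) (L := 2 * L + 1) r.ρ β) := by
          rw [integral_const_mul, integral_finsetSum _ fun q _ => hq2int _]
      _ ≤ m * ∑ _q : {q : Fin 4 × Fin 4 // q.1 < q.2}, K / β ^ 2 := by
          gcongr with q _
          exact hmom2 _
      _ = m * (m * (K / β ^ 2)) := by rw [Finset.sum_const, nsmul_eq_mul, Finset.card_univ, hmdef]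
  -- the covariance identity and the bound
  have hcov : torusE G r β L (fun U => dens G r x U * dens G r y U) -
      torusE G r β L (dens G r x) * torusE G r β L (dens G r y) =
      (∫ U, Φ x U * Φ y U ∂(wilsonMeasure (d := 4) (L := 2 * L + 1) r.ρ β)) -
        (∫ U, Φ x U ∂(wilsonMeasure (d := 4) (L := 2 * L + 1) r.ρ β)) *
          (∫ U, Φ y U ∂(wilsonMeasure (d := 4) (L := 2 * L + 1) r.ρ β)) := by
    unfold torusE
    simp only [hdens]
    exact integral_const_sub_mul_const_sub _ (hΦint x) (hΦint y) hΦΦint c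
  rw [hcov]
  have hprodint : Integrable (fun U => (Φ x U ^ 2 + Φ y U ^ 2) / 2)
      (wilsonMeasure (d := 4) (L := 2 * L + 1) r.ρ β) := ((hΦ2int x).add (hΦ2int y)).div_const 2
  have hprod : ∫ U, Φ x U * Φ y U ∂(wilsonMeasure (d := 4) (L := 2 * L + 1) r.ρ β) ≤
      (∫ U, Φ x U ^ 2 ∂(wilsonMeasure (d := 4) (L := 2 * L + 1) r.ρ β) +
        ∫ U, Φ y U ^ 2 ∂(wilsonMeasure (d := 4) (L := 2 * L + 1) r.ρ β)) / 2 := by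
    have hpt : ∀ U, Φ x U * Φ y U ≤ (Φ x U ^ 2 + Φ y U ^ 2) / 2 := fun U => by
      linarith [two_mul_le_add_sq (Φ x U) (Φ y U)]
    calc ∫ U, Φ x U * Φ y U ∂(wilsonMeasure (d := 4) (L := 2 * L + 1) r.ρ β)
        ≤ ∫ U, (Φ x U ^ 2 + Φ y U ^ 2) / 2 ∂(wilsonMeasure (d := 4) (L := 2 * L + 1) r.ρ β) :=
          integral_mono hΦΦint hprodint hpt
      _ = (∫ U, Φ x U ^ 2 ∂(wilsonMeasure (d := 4) (L := 2 * L + 1) r.ρ β) +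
            ∫ U, Φ y U ^ 2 ∂(wilsonMeasure (d := 4) (L := 2 * L + 1) r.ρ β)) / 2 := by
          rw [integral_div, integral_add (hΦ2int x) (hΦ2int y)]
  have hE0 : ∀ z, 0 ≤ ∫ U, Φ z U ∂(wilsonMeasure (d := 4) (L := 2 * L + 1) r.ρ β) := fun z =>
    integral_nonneg fun U => hΦ0 z U
  have hP0 : 0 ≤ ∫ U, Φ x U * Φ y U ∂(wilsonMeasure (d := 4) (L := 2 * L + 1) r.ρ β) :=
    integral_nonneg fun U => mul_nonneg (hΦ0 x U) (hΦ0 y U)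
  calc |(∫ U, Φ x U * Φ y U ∂(wilsonMeasure (d := 4) (L := 2 * L + 1) r.ρ β)) -
        (∫ U, Φ x U ∂(wilsonMeasure (d := 4) (L := 2 * L + 1) r.ρ β)) *
          (∫ U, Φ y U ∂(wilsonMeasure (d := 4) (L := 2 * L + 1) r.ρ β))|
      ≤ |∫ U, Φ x U * Φ y U ∂(wilsonMeasure (d := 4) (L := 2 * L + 1) r.ρ β)| +
          |(∫ U, Φ x U ∂(wilsonMeasure (d := 4) (L := 2 * L + 1) r.ρ β)) *
            (∫ U, Φ y U ∂(wilsonMeasure (d := 4) (L := 2 * L + 1) r.ρ β))| := abs_sub _ _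
    _ = (∫ U, Φ x U * Φ y U ∂(wilsonMeasure (d := 4) (L := 2 * L + 1) r.ρ β)) +
          (∫ U, Φ x U ∂(wilsonMeasure (d := 4) (L := 2 * L + 1) r.ρ β)) *
            (∫ U, Φ y U ∂(wilsonMeasure (d := 4) (L := 2 * L + 1) r.ρ β)) := by
        rw [abs_of_nonneg hP0, abs_of_nonneg (mul_nonneg (hE0 x) (hE0 y))]
    _ ≤ (m * (m * (K / β ^ 2)) + m * (m * (K / β ^ 2))) / 2 + (m * (K / β)) * (m * (K / β)) := by
        have h1 := hprod.trans (div_le_div_of_nonneg_right (add_le_add (hsq x) (hsq y)) (by norm_num : (0:ℝ) ≤ 2))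
        have hB0 : 0 ≤ m * (K / β) := by positivity
        have h2 := mul_le_mul (hmean x) (hmean y) (hE0 y) hB0
        exact add_le_add h1 h2
    _ = (m ^ 2 * K + (m * K) ^ 2) / β ^ 2 := by
        field_simp
        ring

end Covariance

/-! ## §2 The sharp `Q2` ceiling at every unit, uniformly in the odd torus -/

section Q2Sharp

variable {G : Type} [Group G] [TopologicalSpace G] [IsTopologicalGroup G] [CompactSpace G]
  [MeasurableSpace G] [BorelSpace G] (r : LatticeRep G)

/-- **`Q2` at weak coupling, every unit, every odd torus, WITHOUT the logarithm**: for a lattice representation `r` and test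
functions `f, g` there is `K ≥ 0` with `|Q2 G r β L s f g| ≤ K / (β² · min(s,1)⁸)` for all `L ≥ 1`, `β ≥ 4`, `s > 0`
(`|Q2| ≤ (Σ|f(s x)|)(Σ|g(s y)|) · sup |Cov|`, §1 and `AfOnset.exists_sum_abs_schwartz_lattice_le_div_min`). [folklore] -/
-- adapted from `AfOnset.exists_abs_Q2_le_log_sq` (`Theorems/BalabanLadderIRAfOnsetLatticeAF`), with the sharp covariance bound
theorem exists_abs_Q2_le_sharp (f g : 𝓢((EuclideanSpace ℝ (Fin 4)), ℝ)) :
    ∃ K : ℝ, 0 ≤ K ∧ ∀ (L : ℕ), 1 ≤ L → ∀ β : ℝ, 4 ≤ β → ∀ s : ℝ, 0 < s →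
      |Q2 G r β L s f g| ≤ K / (β ^ 2 * (min s 1) ^ 8) := by
  classical
  obtain ⟨W, hW0, hW⟩ := exists_abs_torusCov_dens_le_sharp r
  obtain ⟨Kf, hKf0, hKf⟩ := exists_sum_abs_schwartz_lattice_le_div_min f
  obtain ⟨Kg, hKg0, hKg⟩ := exists_sum_abs_schwartz_lattice_le_div_min g
  refine ⟨Kf * Kg * W, by positivity, fun L hL β hβ s hs => ?_⟩
  have hβ0 : 0 < β := by linarith
  have hs'0 : 0 < min s 1 := lt_min hs one_pos
  set w : ℝ := W / β ^ 2 with hw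
  have hw0 : 0 ≤ w := by positivity
  have hterm : ∀ x ∈ box 4 L, ∀ y ∈ box 4 L,
      |f (s • siteToE x) * g (s • siteToE y) *
        (torusE G r β L (fun U => dens G r x U * dens G r y U) -
          torusE G r β L (dens G r x) * torusE G r β L (dens G r y))| ≤
      |f (s • siteToE x)| * |g (s • siteToE y)| * w := by
    intro x _ y _
    rw [abs_mul, abs_mul]
    exact mul_le_mul_of_nonneg_left (hW L hL β hβ x y) (mul_nonneg (abs_nonneg _) (abs_nonneg _))
  have hF : ∑ x ∈ box 4 L, |f (s • siteToE x)| ≤ Kf / (min s 1) ^ 4 := hKf s hs _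
  have hGs : ∑ y ∈ box 4 L, |g (s • siteToE y)| ≤ Kg / (min s 1) ^ 4 := hKg s hs _
  have hFn : 0 ≤ ∑ x ∈ box 4 L, |f (s • siteToE x)| := Finset.sum_nonneg fun _ _ => abs_nonneg _
  have hGn : 0 ≤ ∑ y ∈ box 4 L, |g (s • siteToE y)| := Finset.sum_nonneg fun _ _ => abs_nonneg _
  unfold Q2
  calc |∑ x ∈ box 4 L, ∑ y ∈ box 4 L, f (s • siteToE x) * g (s • siteToE y) *
          (torusE G r β L (fun U => dens G r x U * dens G r y U) -
            torusE G r β L (dens G r x) * torusE G r β L (dens G r y))|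
      ≤ ∑ x ∈ box 4 L, |∑ y ∈ box 4 L, f (s • siteToE x) * g (s • siteToE y) *
          (torusE G r β L (fun U => dens G r x U * dens G r y U) -
            torusE G r β L (dens G r x) * torusE G r β L (dens G r y))| :=
        Finset.abs_sum_le_sum_abs _ _
    _ ≤ ∑ x ∈ box 4 L, ∑ y ∈ box 4 L, |f (s • siteToE x) * g (s • siteToE y) *
          (torusE G r β L (fun U => dens G r x U * dens G r y U) -
            torusE G r β L (dens G r x) * torusE G r β L (dens G r y))| :=
        Finset.sum_le_sum fun x _ => Finset.abs_sum_le_sum_abs _ _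
    _ ≤ ∑ x ∈ box 4 L, ∑ y ∈ box 4 L, |f (s • siteToE x)| * |g (s • siteToE y)| * w :=
        Finset.sum_le_sum fun x hx => Finset.sum_le_sum fun y hy => hterm x hx y hy
    _ = (∑ x ∈ box 4 L, |f (s • siteToE x)|) * (∑ y ∈ box 4 L, |g (s • siteToE y)|) * w := by
        rw [Finset.sum_mul_sum, Finset.sum_mul]
        refine Finset.sum_congr rfl fun x _ => ?_
        rw [Finset.sum_mul]
    _ ≤ (Kf / (min s 1) ^ 4) * (Kg / (min s 1) ^ 4) * w := by gcongr
    _ = Kf * Kg * W / (β ^ 2 * (min s 1) ^ 8) := by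
        rw [hw]
        field_simp

end Q2Sharp

/-! ## §3 The unit envelope of an NT unit: `a(β) ≤ K^{1/8} β^{−1/4}`, no logarithm -/

section Envelope

variable {G : Type} [Group G] [TopologicalSpace G] [IsTopologicalGroup G] [CompactSpace G]
  [MeasurableSpace G] [BorelSpace G]

/-- **A two-point floor calibrates the unit (coarse side), sharp form**: if a positive unit map `a` carries
`ε ≤ Q2 G r β L (a β) f g` (`ε > 0`) on SOME torus `2L+1`, `L ≥ 1`, for every `β ≥ β₅`, then `min(a β, 1)⁸ · β² ≤ K` for all
`β ≥ max β₅ 4` (`K ≥ 0` depends on `r, f, g, ε`). [folklore] -/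
-- adapted from `UnitNormalForm.unit_calibration_of_q2Floor` (`Theorems/BalabanLadderNTUnitNormalForm`)
theorem unit_calibration_of_q2Floor_sharp (r : LatticeRep G) (a : ℝ → ℝ) (ha : ∀ β, 0 < a β)
    (f g : 𝓢(EuclideanSpace ℝ (Fin 4), ℝ)) {ε β₅ : ℝ} (hε : 0 < ε)
    (hfloor : ∀ β : ℝ, β₅ ≤ β → ∃ L : ℕ, 1 ≤ L ∧ ε ≤ Q2 G r β L (a β) f g) :
    ∃ K : ℝ, 0 ≤ K ∧ ∀ β : ℝ, max β₅ 4 ≤ β → (min (a β) 1) ^ 8 * β ^ 2 ≤ K := by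
  obtain ⟨K, hK0, hK⟩ := exists_abs_Q2_le_sharp r f g
  refine ⟨K / ε, div_nonneg hK0 hε.le, fun β hβ => ?_⟩
  have hβ5 : β₅ ≤ β := le_trans (le_max_left _ _) hβ
  have hβ4 : 4 ≤ β := le_trans (le_max_right _ _) hβ
  obtain ⟨L, hL1, hlo⟩ := hfloor β hβ5
  have hup := hK L hL1 β hβ4 (a β) (ha β)
  have hm0 : 0 < min (a β) 1 := lt_min (ha β) one_pos
  have hβ0 : 0 < β := by linarith
  have hden : 0 < β ^ 2 * (min (a β) 1) ^ 8 := by positivity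
  have h1 : ε ≤ K / (β ^ 2 * (min (a β) 1) ^ 8) := hlo.trans ((le_abs_self _).trans hup)
  rw [le_div_iff₀ hden] at h1
  rw [le_div_iff₀ hε]
  linarith [mul_comm ε (β ^ 2 * (min (a β) 1) ^ 8)]

/-- **The explicit coarse-side rate, sharp form**: under the hypotheses of `unit_calibration_of_q2Floor_sharp`, for all large `β`,
`a β < 1` and `a β ^ 8 ≤ K / β²`. [folklore] -/
theorem unit_pow_eight_le_of_q2Floor_sharp (r : LatticeRep G) (a : ℝ → ℝ) (ha : ∀ β, 0 < a β)
    (f g : 𝓢(EuclideanSpace ℝ (Fin 4), ℝ)) {ε β₅ : ℝ} (hε : 0 < ε)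
    (hfloor : ∀ β : ℝ, β₅ ≤ β → ∃ L : ℕ, 1 ≤ L ∧ ε ≤ Q2 G r β L (a β) f g) :
    ∃ K β₁ : ℝ, 0 ≤ K ∧ ∀ β : ℝ, β₁ ≤ β → a β < 1 ∧ a β ^ 8 ≤ K / β ^ 2 := by
  obtain ⟨K, hK0, hK⟩ := unit_calibration_of_q2Floor_sharp r a ha f g hε hfloor
  -- beyond `β₁ = max (max β₅ 4) (√K + 1)` we have `K / β² < 1`
  refine ⟨K, max (max β₅ 4) (Real.sqrt K + 1), hK0, fun β hβ => ?_⟩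
  have h1 := hK β (le_trans (le_max_left _ _) hβ)
  have hβK : Real.sqrt K + 1 ≤ β := le_trans (le_max_right _ _) hβ
  have hβ4 : 4 ≤ β := le_trans (le_max_right _ _) (le_trans (le_max_left _ _) hβ)
  have hβ0 : 0 < β := by linarith
  have hβ2 : 0 < β ^ 2 := by positivity
  have hKlt : K < β ^ 2 := by
    have hs : Real.sqrt K < β := by linarith
    have hs0 : 0 ≤ Real.sqrt K := Real.sqrt_nonneg K
    calc K = Real.sqrt K ^ 2 := (Real.sq_sqrt hK0).symm
      _ < β ^ 2 := by exact pow_lt_pow_left₀ hs hs0 two_ne_zero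
  have h3 : (min (a β) 1) ^ 8 ≤ K / β ^ 2 := by rw [le_div_iff₀ hβ2]; exact h1
  have h4 : K / β ^ 2 < 1 := (div_lt_one hβ2).2 hKlt
  have hm0 : 0 ≤ min (a β) 1 := le_min (ha β).le zero_le_one
  have hlt : min (a β) 1 < 1 := by
    by_contra hge
    rw [not_lt] at hge
    have : (1 : ℝ) ≤ (min (a β) 1) ^ 8 := one_le_pow₀ hge
    linarith
  have hmin : min (a β) 1 = a β := min_eq_left (le_of_lt (by simpa using (min_lt_iff.1 hlt)))
  exact ⟨by simpa [hmin] using hlt, by simpa [hmin] using h3⟩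

/-- **The sharp coarse-side rate of an NT unit**: `LowerBounds G r a`, `0 < a` ⇒ for all large `β`, `a β < 1` and
`a β ^ 8 ≤ K / β²` (one large torus per coupling carries the clause-(i) floor). [folklore] -/
-- adapted from `UnitNormalForm.unit_pow_eight_le_of_lowerBounds`
theorem unit_pow_eight_le_of_lowerBounds_sharp (r : LatticeRep G) (a : ℝ → ℝ) (ha : ∀ β, 0 < a β)
    (hlb : LowerBounds G r a) :
    ∃ K β₁ : ℝ, 0 ≤ K ∧ ∀ β : ℝ, β₁ ≤ β → a β < 1 ∧ a β ^ 8 ≤ K / β ^ 2 := by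
  obtain ⟨⟨v, ε, β₅, Λ₅, -, hε, hfloor⟩, -⟩ := hlb
  refine unit_pow_eight_le_of_q2Floor_sharp r a ha (thetaTest 4 v) v hε (β₅ := β₅) fun β hβ => ?_
  refine ⟨⌈Λ₅ / a β⌉₊ + 1, by omega, hfloor β hβ _ ?_⟩
  have h1 : Λ₅ / a β ≤ (⌈Λ₅ / a β⌉₊ : ℝ) := Nat.le_ceil _
  have h2 : (⌈Λ₅ / a β⌉₊ : ℝ) ≤ ((⌈Λ₅ / a β⌉₊ + 1 : ℕ) : ℝ) := by push_cast; linarith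
  have h3 : Λ₅ / a β ≤ ((⌈Λ₅ / a β⌉₊ + 1 : ℕ) : ℝ) := h1.trans h2
  rw [div_le_iff₀ (ha β)] at h3
  linarith [mul_comm (((⌈Λ₅ / a β⌉₊ + 1 : ℕ) : ℝ)) (a β)]

/-- **The unit envelope `a(β) ≤ K^{1/8} · β^{−1/4}`** of a positive unit map carrying clause (i) of `LowerBounds G r a` (in
particular of the unit of `BalabanLadder.NT`), for all large `β` — no logarithm. [folklore] -/
theorem unit_le_rpow_of_lowerBounds (r : LatticeRep G) (a : ℝ → ℝ) (ha : ∀ β, 0 < a β)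
    (hlb : LowerBounds G r a) :
    ∃ K β₁ : ℝ, 0 ≤ K ∧ ∀ β : ℝ, β₁ ≤ β → a β ≤ K * β ^ (-(1 / 4 : ℝ)) := by
  obtain ⟨K, β₁, hK0, hK⟩ := unit_pow_eight_le_of_lowerBounds_sharp r a ha hlb
  refine ⟨K ^ (1 / 8 : ℝ), max β₁ 1, by positivity, fun β hβ => ?_⟩
  obtain ⟨-, h8⟩ := hK β (le_trans (le_max_left _ _) hβ)
  have hβ1 : 1 ≤ β := le_trans (le_max_right _ _) hβ
  have hβ0 : 0 < β := by linarith
  have ha0 : 0 ≤ a β := (ha β).le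
  -- take eighth roots: `a β = ((a β)^8)^{1/8} ≤ (K / β²)^{1/8} = K^{1/8} β^{-1/4}`
  have h1 : a β = (a β ^ 8) ^ (1 / 8 : ℝ) := by
    rw [← Real.rpow_natCast, ← Real.rpow_mul ha0]; norm_num
  have h2 : (a β ^ 8) ^ (1 / 8 : ℝ) ≤ (K / β ^ 2) ^ (1 / 8 : ℝ) :=
    Real.rpow_le_rpow (by positivity) h8 (by norm_num)
  have h3 : (K / β ^ 2) ^ (1 / 8 : ℝ) = K ^ (1 / 8 : ℝ) * β ^ (-(1 / 4 : ℝ)) := by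
    rw [Real.div_rpow hK0 (by positivity), ← Real.rpow_natCast β 2, ← Real.rpow_mul hβ0.le,
      div_eq_mul_inv, ← Real.rpow_neg hβ0.le]
    norm_num
  calc a β = (a β ^ 8) ^ (1 / 8 : ℝ) := h1
    _ ≤ (K / β ^ 2) ^ (1 / 8 : ℝ) := h2
    _ = K ^ (1 / 8 : ℝ) * β ^ (-(1 / 4 : ℝ)) := h3

end Envelope

end Summit.QuantumFields.YangMills.Cruxes.NT.SharpCeilings

end
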